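import Literature.MathematicalPhysics.QuantumFieldTheory.Balaban1983to89.B9SupplySockB9P3ZdAllLettersZdPer
import Literature.MathematicalPhysics.QuantumFieldTheory.Balaban1983to89.B9Thm311FlatKernelZdPer
import Literature.MathematicalPhysics.QuantumFieldTheory.Balaban1983to89.B9Thm311FlatHermKernelZd
import Literature.MathematicalPhysics.QuantumFieldTheory.Balaban1983to89.B9Eq324DeltaPrimeAZdPer
import Literature.MathematicalPhysics.QuantumFieldTheory.Balaban1983to89.B8Thm2TorusMember

/-!
# `Balaban1983to89.B9Thm311FlatPositivityZdPer` — [Balaban1985BackgroundPropagators] THEOREM 3.11 AT THE FLAT BACKGROUND FOR THE GENUINE TORUS RECORD: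
# on the Hermitian periodic carrier `E_𝔤^per(P) = domSubHPer P` of the (β′-PERIODIC) road, at the all-torus constraint class of [Balaban1985RegularSpaces]
# p. 77 («Ω_j = T_η»), the four-letter `Δ_a(1) = D*D + Δ′(1) + D R^per(1) D* + Q*aQ(1)` of the record `opsAllZdPer` is POSITIVE DEFINITE —
# `⟨A, Δ_a(1)A⟩_per > 0` for every periodic Hermitian `A ≠ 0` — hence `RegularAtHPer` (the flat inhabitant of the binder `InvAtHIPer`'s premise) holds at `U₀ = 1`;
# on the way, THE SUMMED PAIRING IDENTITY ON THE PERIOD CELL (`Q_jᵀ` is the transpose of `LʲQ_j(U₀)` for periodic data, any periodic `U₀` in the class (1.7))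

statement-level skeleton of published theorems with citation tags; proofs where landed; nothing here is a claim about the
Yang–Mills mass gap

`[Balaban1985BackgroundPropagators]` ("B9", CMP **99** (1985) 389–434) Thm 3.11 p. 416 *«the operators Δ′_a, G′, (Q′G′²Q′*)⁻¹, Δ_a, G are positive definite»*, proof,
last lines: *«In [4] we have proved that the operator G_□(1) is positive»*; (3.26) p. 395 «Δ_a = Δ + DRD* + Q*aQ», (3.10) p. 392 «Δ = D*D + Δ′», (3.16)–(3.17) p. 393
(the averaging term and the pairing), (3.20)–(3.22) p. 394 (the Landau term `‖RD*A‖²`), (3.27) p. 395 (`G = Δ_a⁻¹`), (3.115) p. 418 «Q_j d = D_j Q′_j».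
`[Balaban1984PropagatorsI]` ("B5", CMP **95**) (1.72) p. 30 *«Thus if for some A we have Δ_aA = 0, then … A₀ = 0, ω = 0»*; `[Balaban1984PropagatorsII]` ("[4]" of
Thm 3.11's proof, CMP **96**) (2.11) p. 225 *«the Laplace operator Δ is positive on the subspace N(Q′)»*.  `[Balaban1985RegularSpaces]` ("B8", CMP **99** 75–102)
p. 77 *«we admit the case where some domains Ω_j are equal to T_η»*, (1.5)–(1.6) p. 77, (1.37) p. 82, (1.56), (1.58) p. 86.  `[Balaban1985Averaging]` ("B7",
CMP **98**) (127) p. 37, (141) p. 39, (147), (150) p. 40, p. 24 (the window of a bond).  PDF held: `paper:balaban1985-cmp99-background-propagators` pp. 392–395,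
416, 418 (via the lineage's `B9Eq327GreenZdHermPer` ∕ `B9Thm311FlatHermKernelZd` docstrings, re-read 2026-08-28).

CITATION HEADER (lean-in-tree rule).  Cell `pub-ymgap` (YM Track A, HUMAN RULINGS D-0062 ∕ D-0149), node N06 = [B9]; seat `pub-ymgap-dag-n06-b` (g23), the
junction ∕ letter lineage of J-N06→N05 and owner of the N06 object layer of the (β′-PERIODIC) road (director-ym №217, plan PENS-217; g22: `B9Eq327GreenZdHermPer`
p638598, `B9Eq326DeltaAPeriodicLettersZd` p640598, `B9SupplySockB9P3ZdAllLettersZdPer` p641100, `B8LeafModelZd3SockPer` p641252, `B9SupplySockB9P3ZdPer` p643074).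
TRIGGER: dag-n06-w4 g6's word ask (bus 2026-08-28 15:01Z) «which decl states `0 < bondPairPer τ P A (deltaAOf i.η (opsAllZdPer …) 1 A)` for `A ∈ domSubHPer P ∖ 0`»
— the displayed `hpos1` of their openness file `B9Thm311PosDefOpenZdPer` — and dag-n06-w3 g6's `B9Thm311FlatKernelZdPer` (the flat Hodge kernel with the
`R`∕`Q` halves displayed, «dag-n06-b … discharges the displayed halves by name»); dag-n06-w3 ∕ -w4 «NOT MINE — GO» (bus 15:26Z).  WHY.  On the torus the N06
binder `InvAtHIPer` ∕ `RegularInClassAtHPer` is supplied from POSITIVITY of `⟨A, Δ_a(U₀)A⟩_per` (`regularAtHPer_opsAllZdPer_of_pos`, p641100); its inhabitant at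
`U₀ = 1` for the GENUINE record is print's [4]-base case «G_□(1) is positive», i.e. [B5] (1.72): the flat form is `Σ|D¹A|² + ‖R(1)D¹*A‖² + η Σ_j w_j Σ|LʲηQ_j(1)A|²`
and the three squares vanish jointly only at `A = 0`.  The first two squares and the Hodge endgame are in the tree (p638598's energy identity, p641100's Landau
square, dag-n06-w3's kernel); THIS FILE supplies the third square ON THE PERIOD CELL — which needs the summed pairing identity for the transpose `Q_jᵀ` on the
torus (§2, the periodic twin of the lineage's `tauForm_linCovIterT_pair`) — and the two consequences (Q₁) «no harmonic part» and (Q₂) «potential `Q′(1)`-null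
up to a constant» of `Q_m(1)A ≡ 0` at the all-torus class, then assembles.

WHAT IS PROVED (kernel, 0 sorry; theorems only (+ one private helper); no `def`, no `instance`, no `notation`).
* §0 `exists_bound_of_isPeriodic_site ∕ _bond` (periodic ⟹ bounded).
* §1 window arithmetic: `winBase_add_shift_mem_box`, `sub_shift_mem_box_of_winBase_mem_box`, ★ `sum_box_coarse_fibre` (THE FUNDAMENTAL-DOMAIN SWAP: summing a
  `P`-periodic `g` over the fibres of `x ↦ winBase L j x κ t` above the coarse cell `[0,P∕Lʲ)ᵈ` is summing it over the fine cell `[0,P)ᵈ`).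
* §2 `linCovIter_bump_add_period` (joint periodicity of the columns of (147)), ★★ `sum_box_tauForm_linCovIterT_eq` (THE SUMMED PAIRING IDENTITY ON THE PERIOD
  CELL, any periodic unitary `U₀` in the class (1.7), any class `T` with boxes in `Ω_j`: `Σ_μΣ_{x∈[0,P)ᵈ}⟨(Q_jᵀB)(x,μ), A(x,μ)⟩_τ = Σ_κΣ_{y∈[0,P∕Lʲ)ᵈ}⟨B(y,κ), (LʲQ_j(U₀)A)(y,κ)⟩_τ`
  — the finite identity applied coarse bond by coarse bond with the singleton class and `A` cut to the box (locality `B9Ineq3137LocalSup.linCovIter_congr`), re-summed by §1).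
* §3 ★★ `bondPairPer_QQZdP_eq_sum` (`⟨A, Q*aQ(U₀)A⟩_per` level by level at a periodic `U₀` in the letter's regime, print's box law «box ⊂ Ω_{j−1}» via
  `reg17_shift`), ★★ `bondPairPer_QQZdP_one_eq` (at `U₀ = 1`: `= η Σ_{j≤m} w_j Σ_κ Σ_{y∈[0,P∕Lʲ)ᵈ, (y,κ)∈Λ_j} Re τ|LʲηQ_j(1)A|²`, no box law).
* §4 `projRPer_covDivB_eq_coe`, ★★★ `kernel_conditions_per_of_bondPairPer_nonpos` (`⟨A, Δ_a(1)A⟩_per ≤ 0` ⟹ closed on the cell ∧ `R^per(1)D¹*A = 0` ∧ all class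
  averages in the coarse cells vanish — any member with `Lᵐ ∣ P` and periodic class sections).
* §5 the all-torus class: `linQIter_const` (`Q_j(1)` of a direction-constant field is `Lʲ` times it), ★ `linCovIter_one_of_potential_add_const` ((3.115) at `U = 1`
  plus constants: `LʲηQ_j(1)(D¹λ + v) = η⁻¹·d_coarse(Q′_j(1)λ) + Lʲ·v`), ★ `const_eq_zero_of_linCovIter_one_eq_zero` ((Q₁), torus telescoping of the periodic
  `Q′_m(1)λ`, dag-n06-w4's `isPeriodic_QprimeIter`), ★ `exists_sub_const_mem_gaugeNullPer` ((Q₂), dag-n06-w3's torus Liouville + dag-n06-w4's `qprimeIter_one_const`).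
* §6 `isPeriodic_mem_torusLamb`, ★★★ `eq_zero_of_bondPairPer_deltaAOf_opsAllZdPer_one_nonpos` (the kernel: `i.Λs m = torusLam m`, `ΛbP m = torusLamb m`, `Lᵐ ∣ P`,
  `A ∈ domSubHPer P`, `⟨A, Δ_a(1)A⟩_per ≤ 0` ⟹ `A = 0`), ★★★ `bondPairPer_deltaAOf_opsAllZdPer_one_pos` (`A ≠ 0` ⟹ `0 < ⟨A, Δ_a(1)A⟩_per` — dag-n06-w4's `hpos1`),
  ★★ `regularAtHPer_opsAllZdPer_one` (`Ω_j = ℤᵈ` ⟹ `RegularAtHPer … P 1` for the genuine record, via p641100), ★★ `regularAtHPer_opsAllZdPer_one_torusIdx` (both at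
  lit-balaban's `torusIdx hL t`, record class `(torusIdx hL t).Λb`, by `rfl`).

HONEST SCOPE.  (i) Theorem 3.11's positivity of `Δ_a` at ONE background `U = 1` on the torus carrier for the ALL-TORUS class only (print's base case [4]); the
general periodised-tower classes of dag-n05-w2's `B8IdxB8SubDPeriodize` need the periodic twin of dag-n05-w3's ray escape for (Q₁)∕(Q₂) — NOT here (§2–§4 are
class-general).  NOT Theorem 3.11 at curved `U₀` (dag-n06-w4's openness road supplies a neighbourhood of `1`), no estimate, no uniformity in the member, no
coercivity constant (dag-n06-w3's `B9Eq190FlatCoercivityZdPer` road is the quantitative twin).  (ii) Count-neutral (`--supports` the K1 item of record); N05 ∕ N06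
NOT discharged; K1⁹ NOT closed; counts UNMOVED; one finite `𝕋⁴` programme at fixed `ε`, Bałaban as printed; R4 closes only the conditional finite-`𝕋⁴` rung
`BalabanLadder.UV` — nothing continuum ∕ ℝ⁴ ∕ OS ∕ mass gap ∕ Clay.  Unit `pub-ymgap-dag-n06-b` (g23), 2026-08-28; NEW file importing the lineage's
`B9SupplySockB9P3ZdAllLettersZdPer` ∕ `B9Thm311FlatHermKernelZd`, dag-n06-w3's `B9Thm311FlatKernelZdPer`, dag-n06-w4's `B9Eq324DeltaPrimeAZdPer` and lit-balaban's
`B8Thm2TorusMember`; modifies nothing.  Net new unproved facts: 0.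
-/

noncomputable section

open scoped BigOperators

namespace Literature.MathematicalPhysics.QuantumFieldTheory.Balaban1983to89.B9Thm311FlatPositivityZdPer

open Literature.MathematicalPhysics.QuantumLattice (blockSites)
open B7Prop1Explicit B7Eq78Linearization
open B7Prop1Local (InBox loK bondHiK AgreeOn)
open B7Prop2Explicit (unitaryUnits)
open B7Prop5Flat (bump boxFinset mem_boxFinset)
open B7Prop4GeneralLevels (linCovIter)
open B7TranslationCovariance (linCovIter_shiftCfg)
open B8Ineq132 (covDerivFwd covDeriv)
open B8Eq146AExpansion (plaqCovDeriv)
open B8Eq138LandauZd (covDivB covLap)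
open B8Eq155JBound (Jcur)
open B8LeafModelZd (ZdIdx)
open B8Eq119TwistedAxial (bgT bgT_one)
open B12Ineq417Flat (shiftCfg)
open T4TermwiseTorus (IsPeriodic box mem_box tcls tlift tlift_mem_box)
open B9SupplySockB9P3ZdLetters (OpsZd deltaAOf)
open B9Eq316AveragingTransposeZd (tauForm tauForm_apply entryT linCovIterT winBase inBox_winBase clsField wQ Reg17 alphaQ alphaQ_pos reg17_one
  tauForm_isSymm)
open B9Eq316AveragingTransposeZdPrinted (QQZdP withQQP QQZdP_of_reg17 tauForm_linCovIterT_pair reg17_shift)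
open B9Eq326DeltaAPeriodicLettersZd (linCovIter_add_period winBase_add_pow_mul_smul shiftCfg_eq_self_of_isPeriodic shiftCfg_bump isPeriodic_clsField)
open B9Eq327GreenZdHermPer (domSubHPer bondPairPer RegularAtHPer sum_box_shift sum_box_pair_Jcur isPeriodic_apply_dir)
open B9Eq321LandauProjectionZdPer (perSub formPer perRestrict perRestrict_eq_self gaugeNullPer projEPer projRPer isPeriodic_covDivB formPer_apply
  formPer_apply_self_eq_zero)
open B9SupplySockB9P3ZdAllLettersZdPer (opsAllZdPer opsLandauPer opsLandauPer_DRDs bondPairPer_deltaAOf_opsAllZdPer_eq_four_terms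
  bondPairPer_DRDs_eq_formPer_sq regularAtHPer_opsAllZdPer_of_pos)
open B9SupplySockB9P3ZdGammaInAkDpZd (withDpZd)
open B9Eq369CurvSmallZd (DpZd DpZd_one)
open B9Eq326GaugeTermSquareZd (re_trace_star_pair_invariant)

-- `Site` alone could resolve to the torus sites of `Setup.lean`; re-export the `ℤ^d` sites of `B7Prop1Explicit`.
export B7Prop1Explicit (Site)

variable {d : ℕ} {𝔸 : Type*} [CStarAlgebra 𝔸]

/-! ## §0  Plumbing: periodic fields are bounded; the transposed entry of `0` -/

section Plumbing

variable (P : ℕ) [NeZero P]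

omit [CStarAlgebra 𝔸] in
/-- a `P`-periodic site function takes finitely many values, hence is bounded (by the sum of the norms over one cell).
[cite: Balaban1985RegularSpaces, p.77 («Ω_j = T_η»; bookkeeping)] -/
theorem exists_bound_of_isPeriodic_site {𝔸 : Type*} [SeminormedAddCommGroup 𝔸] {lam : Site d → 𝔸} (h : IsPeriodic P lam) :
    ∃ Λ : ℝ, 0 ≤ Λ ∧ ∀ x, ‖lam x‖ ≤ Λ := by
  refine ⟨∑ y ∈ box (d := d) P, ‖lam y‖, Finset.sum_nonneg fun _ _ => norm_nonneg _, fun x => ?_⟩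
  rw [← h.apply_tlift x]
  exact Finset.single_le_sum (f := fun y => ‖lam y‖) (fun _ _ => norm_nonneg _) (tlift_mem_box _)

omit [CStarAlgebra 𝔸] in
/-- a `P`-periodic bond field is bounded. [cite: Balaban1985RegularSpaces, p.77 («Ω_j = T_η»; bookkeeping)] -/
theorem exists_bound_of_isPeriodic_bond {𝔸 : Type*} [SeminormedAddCommGroup 𝔸] {A : Site d → Fin d → 𝔸} (h : IsPeriodic P A) :
    ∃ M₀ : ℝ, 0 ≤ M₀ ∧ ∀ x κ, ‖A x κ‖ ≤ M₀ := by
  refine ⟨∑ y ∈ box (d := d) P, ∑ κ : Fin d, ‖A y κ‖, Finset.sum_nonneg fun _ _ => Finset.sum_nonneg fun _ _ => norm_nonneg _,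
    fun x κ => ?_⟩
  have hx : A x = A (tlift (tcls P x)) := (h.apply_tlift x).symm
  rw [hx]
  have h1 : ‖A (tlift (tcls P x)) κ‖ ≤ ∑ κ' : Fin d, ‖A (tlift (tcls P x)) κ'‖ :=
    Finset.single_le_sum (f := fun κ' => ‖A (tlift (tcls P x)) κ'‖) (fun _ _ => norm_nonneg _) (Finset.mem_univ κ)
  exact h1.trans (Finset.single_le_sum (f := fun y => ∑ κ' : Fin d, ‖A y κ'‖) (fun _ _ => Finset.sum_nonneg fun _ _ => norm_nonneg _)
    (tlift_mem_box (tcls P x)))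

variable (τ : 𝔸 →ₗ[ℂ] ℂ) [FiniteDimensional ℝ 𝔸]

omit [NeZero P] in
/-- the transposed entry of the zero vector is `0`. [folklore] -/
private theorem entryT_zero (E : 𝔸 → 𝔸) : entryT τ E 0 = 0 := by
  unfold entryT
  split_ifs
  · simp
  · rfl

end Plumbing

/-! ## §1  Window arithmetic: the fundamental-domain swap between fine bonds of the cell `[0,P)ᵈ` and coarse bonds of `[0, P∕Lʲ)ᵈ` -/

section Window

variable {L : ℕ} (hL : 1 ≤ L) (j : ℕ) {P Q : ℕ}

omit [CStarAlgebra 𝔸] in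
include hL in
/-- the window base of a fine site shifted by `t·Lʲ·e_κ` from the cell `[0, LʲQ)ᵈ` lies in the coarse cell `[0, Q)ᵈ`: it is the plain block label
`x ↦ ⌊x∕Lʲ⌋`. [cite: Balaban1985Averaging, p.24 (after (43)); Balaban1985RegularSpaces, p.77 (bookkeeping)] -/
theorem winBase_add_shift_mem_box (hPQ : (P : ℤ) = (L : ℤ) ^ j * Q) (κ : Fin d) (t : Fin 2) {z : Site d} (hz : z ∈ box (d := d) P) :
    winBase L j (z + ((((t : ℕ) : ℤ) * (L : ℤ) ^ j) • e κ)) κ t ∈ box (d := d) Q := by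
  have hN : (0 : ℤ) < (L : ℤ) ^ j := by positivity
  rw [mem_box] at hz ⊢
  intro i
  have hzi := hz i
  have hw : winBase L j (z + ((((t : ℕ) : ℤ) * (L : ℤ) ^ j) • e κ)) κ t i = z i / (L : ℤ) ^ j := by
    simp only [winBase, Pi.add_apply, Pi.smul_apply, e_apply, smul_eq_mul]
    split_ifs with hi
    · rw [mul_one, Int.add_mul_ediv_right _ _ hN.ne']; ring
    · rw [mul_zero, add_zero, sub_zero]
  rw [hw]
  refine ⟨Int.ediv_nonneg hzi.1 hN.le, ?_⟩
  rw [Int.ediv_lt_iff_lt_mul hN]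
  calc z i < (P : ℤ) := hzi.2
    _ = (Q : ℤ) * (L : ℤ) ^ j := by rw [hPQ, mul_comm]

omit [CStarAlgebra 𝔸] in
include hL in
/-- conversely, a fine site whose window base lies in the coarse cell `[0, Q)ᵈ` lies in the fine cell `[0, LʲQ)ᵈ` shifted by `t·Lʲ·e_κ`.
[cite: Balaban1985Averaging, p.24 (after (43)); Balaban1985RegularSpaces, p.77 (bookkeeping)] -/
theorem sub_shift_mem_box_of_winBase_mem_box (hPQ : (P : ℤ) = (L : ℤ) ^ j * Q) (κ : Fin d) (t : Fin 2) {x : Site d}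
    (hx : winBase L j x κ t ∈ box (d := d) Q) : x - ((((t : ℕ) : ℤ) * (L : ℤ) ^ j) • e κ) ∈ box (d := d) P := by
  have hN : (0 : ℤ) < (L : ℤ) ^ j := by positivity
  rw [mem_box] at hx ⊢
  intro i
  obtain ⟨h0, hQ⟩ := hx i
  simp only [winBase] at h0 hQ
  set s : ℤ := if i = κ then ((t : ℕ) : ℤ) else 0 with hs
  have h1 : s * (L : ℤ) ^ j ≤ x i := by
    rw [← Int.le_ediv_iff_mul_le hN]; linarith
  have h2 : x i < (s + Q) * (L : ℤ) ^ j := by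
    rw [← Int.ediv_lt_iff_lt_mul hN]; linarith
  have hv : (x - ((((t : ℕ) : ℤ) * (L : ℤ) ^ j) • e κ)) i = x i - s * (L : ℤ) ^ j := by
    simp only [Pi.sub_apply, Pi.smul_apply, e_apply, smul_eq_mul, hs]
    split_ifs <;> ring
  rw [hv, hPQ]
  constructor <;> nlinarith

variable [NeZero P]

omit [CStarAlgebra 𝔸] in
include hL in
/-- ★ **THE FUNDAMENTAL-DOMAIN SWAP** (window ∕ block bookkeeping on the torus): for a `P`-periodic `g` (`P = Lʲ·Q`), a direction `κ` and a window index
`t`, summing `g` over the fine sites `x` whose window base `winBase L j x κ t` runs over the coarse cell `[0,Q)ᵈ` (fibre by fibre: the fibre over `y` lies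
in the box `Bʲ(y) ∪ Bʲ(y + e_κ)`) is summing `g` over the fine cell `[0,P)ᵈ` — the fibres tile the shifted cell `[0,P)ᵈ + tLʲe_κ`, and the cell sum of a
periodic function is shift invariant (`B9Eq327GreenZdHermPer.sum_box_shift`). [cite: Balaban1985Averaging, p.24 (after (43)), (141) p.39; Balaban1985RegularSpaces, p.77 («Ω_j = T_η»)] -/
theorem sum_box_coarse_fibre (hPQ : (P : ℤ) = (L : ℤ) ^ j * Q) {M : Type*} [AddCommMonoid M] {g : Site d → M} (hg : IsPeriodic P g)
    (κ : Fin d) (t : Fin 2) :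
    ∑ y ∈ box (d := d) Q, ∑ x ∈ (boxFinset (loK L j y) (bondHiK L j y κ)).filter (fun x => winBase L j x κ t = y), g x =
      ∑ x ∈ box (d := d) P, g x := by
  classical
  set v : Site d := ((((t : ℕ) : ℤ) * (L : ℤ) ^ j) • e κ) with hv
  have h1 : ∑ x ∈ box (d := d) P, g x = ∑ x ∈ (box (d := d) P).image (fun z => z + v), g x := by
    rw [Finset.sum_image (fun a _ b _ h => add_right_cancel h), sum_box_shift P hg v]
  have hmaps : ∀ x ∈ (box (d := d) P).image (fun z => z + v), winBase L j x κ t ∈ box (d := d) Q := by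
    intro x hx
    obtain ⟨z, hz, rfl⟩ := Finset.mem_image.1 hx
    exact winBase_add_shift_mem_box hL j hPQ κ t hz
  rw [h1, ← Finset.sum_fiberwise_of_maps_to hmaps]
  refine Finset.sum_congr rfl fun y hy => Finset.sum_congr (Finset.ext fun x => ?_) fun _ _ => rfl
  simp only [Finset.mem_filter, Finset.mem_image, mem_boxFinset]
  constructor
  · rintro ⟨-, hwx⟩
    refine ⟨⟨x - v, sub_shift_mem_box_of_winBase_mem_box hL j hPQ κ t (hwx ▸ hy), sub_add_cancel x v⟩, hwx⟩
  · rintro ⟨-, hwx⟩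
    refine ⟨?_, hwx⟩
    rw [← hwx]
    exact inBox_winBase hL j x κ t

end Window

/-! ## §2  The summed pairing identity on the period cell: `Q_jᵀ` IS the transpose of `LʲQ_j(U₀)` for periodic data -/

section Pairing

variable (τ : 𝔸 →ₗ[ℂ] ℂ) [FiniteDimensional ℝ 𝔸] {L : ℕ} {P Q : ℕ} {U₀ : Site d → Fin d → 𝔸ˣ}

omit [FiniteDimensional ℝ 𝔸] in
/-- **JOINT PERIODICITY OF THE COLUMNS OF (147)**: at a `P`-periodic background with `P = Lʲ·Q`, the column `X ↦ LʲηQ_j(U₀)(X·δ_b)(c)` is unchanged when the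
fine bond `b` moves by `P•n` and the coarse bond `c` by `Q•n` ([B7] (150), `B7TranslationCovariance.linCovIter_shiftCfg`).
[cite: Balaban1985Averaging, (127) p.37, (147), (150) p.40; Balaban1985RegularSpaces, p.77 («Ω_j = T_η»)] -/
theorem linCovIter_bump_add_period (hU : IsPeriodic P U₀) {j : ℕ} (hPQ : (P : ℤ) = (L : ℤ) ^ j * Q) (x w n : Site d) (μ κ : Fin d) (X : 𝔸) :
    linCovIter L U₀ (bump (x + (P : ℤ) • n) μ X) j (w + (Q : ℤ) • n) κ = linCovIter L U₀ (bump x μ X) j w κ := by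
  rw [linCovIter_shiftCfg L U₀ _ j ((Q : ℤ) • n) w κ, smul_smul, ← hPQ, shiftCfg_eq_self_of_isPeriodic hU, shiftCfg_bump]

variable [Nontrivial 𝔸] [NeZero P]

/-- ★★ **THE SUMMED PAIRING IDENTITY ON THE PERIOD CELL — `Q_jᵀ` IS THE `⟨·,·⟩_τ`-TRANSPOSE OF THE COMPOSITE AVERAGING ON THE TORUS**: for a
`P`-periodic unitary `U₀` in the class (1.7) (`α ≤ α_Q`), a level `j ≤ m` with `P = Lʲ·Q`, a class `T` of level-`j` bonds whose boxes lie in `Ω_j`, a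
`Q`-periodic coarse bond field `B` vanishing off `T` and a `P`-periodic fine bond field `A`:
`Σ_μ Σ_{x ∈ [0,P)ᵈ} ⟨(Q_jᵀB)(x,μ), A(x,μ)⟩_τ = Σ_κ Σ_{y ∈ [0,Q)ᵈ} ⟨B(y,κ), (LʲQ_j(U₀)A)(y,κ)⟩_τ` — the periodic twin of the lineage's finite-support
identity `B9Eq316AveragingTransposeZdPrinted.tauForm_linCovIterT_pair` (applied coarse bond by coarse bond with the singleton class `{c}` and `A`
restricted to the box of `c`, locality `B9Ineq3137LocalSup.linCovIter_congr`), re-summed over the torus by the fundamental-domain swap of §1.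
[cite: Balaban1985BackgroundPropagators, (3.16)–(3.17) p.393; Balaban1985Averaging, (127) p.37, (141) p.39, (147) p.40, p.24; Balaban1985RegularSpaces, p.77 («Ω_j = T_η»)] -/
theorem sum_box_tauForm_linCovIterT_eq (hL : 2 ≤ L) (hτp : ∀ a : 𝔸, a ≠ 0 → 0 < (τ (star a * a)).re)
    {m : ℕ} {Ω : ℕ → Set (Site d)} {α : ℝ} (hα : 0 < α) (hαQ : α ≤ alphaQ d L)
    (hU₀ : ∀ x κ, U₀ x κ ∈ unitaryUnits 𝔸) (hU : IsPeriodic P U₀) (hreg : Reg17 L m Ω α U₀) {j : ℕ} (hj : j ≤ m)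
    (hPQ : (P : ℤ) = (L : ℤ) ^ j * Q) (T : Set (Site d × Fin d)) (hT : ∀ c ∈ T, ∀ x, InBox (loK L j c.1) (bondHiK L j c.1 c.2) x → x ∈ Ω j)
    {B : Site d → Fin d → 𝔸} (hBT : ∀ c : Site d × Fin d, c ∉ T → B c.1 c.2 = 0) (hB : IsPeriodic Q B)
    {A : Site d → Fin d → 𝔸} (hA : IsPeriodic P A) :
    ∑ μ : Fin d, ∑ x ∈ box (d := d) P, tauForm τ (linCovIterT τ L U₀ j B x μ) (A x μ) =
      ∑ κ : Fin d, ∑ y ∈ box (d := d) Q, tauForm τ (B y κ) (linCovIter L U₀ A j y κ) := by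
  classical
  have hL1 : 1 ≤ L := le_trans (by norm_num) hL
  -- the transposed column pairing `F x μ y κ = ⟨(col_{(y,κ),(x,μ)})ᵀ B(y,κ), A(x,μ)⟩_τ`
  set F : Site d → Fin d → Site d → Fin d → ℝ :=
    fun x μ y κ => tauForm τ (entryT τ (fun X => linCovIter L U₀ (bump x μ X) j y κ) (B y κ)) (A x μ) with hF
  -- (1) LHS, fine bond by fine bond: unfold the transpose
  have h1 : ∀ (G : Site d → Fin d → 𝔸) (x : Site d) (μ : Fin d), tauForm τ (linCovIterT τ L U₀ j G x μ) (A x μ) =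
      ∑ κ : Fin d, ∑ t : Fin 2, tauForm τ (entryT τ (fun X => linCovIter L U₀ (bump x μ X) j (winBase L j x κ t) κ) (G (winBase L j x κ t) κ)) (A x μ) := by
    intro G x μ
    simp only [linCovIterT, map_sum, LinearMap.sum_apply]
  -- (2) joint periodicity of `F`
  have h2 : ∀ (x : Site d) (μ : Fin d) (y : Site d) (κ : Fin d) (n : Site d), F (x + (P : ℤ) • n) μ (y + (Q : ℤ) • n) κ = F x μ y κ := by
    intro x μ y κ n
    simp only [hF]
    rw [show B (y + (Q : ℤ) • n) κ = B y κ from congrFun (hB y n) κ, show A (x + (P : ℤ) • n) μ = A x μ from congrFun (hA x n) μ]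
    have hcol : (fun X => linCovIter L U₀ (bump (x + (P : ℤ) • n) μ X) j (y + (Q : ℤ) • n) κ) = fun X => linCovIter L U₀ (bump x μ X) j y κ := by
      funext X; exact linCovIter_bump_add_period hU hPQ x y n μ κ X
    rw [hcol]
  -- (3) RHS, coarse bond by coarse bond
  have h3 : ∀ (y : Site d) (κ : Fin d), tauForm τ (B y κ) (linCovIter L U₀ A j y κ) =
      ∑ t : Fin 2, ∑ μ : Fin d, ∑ x ∈ (boxFinset (loK L j y) (bondHiK L j y κ)).filter (fun x => winBase L j x κ t = y), F x μ y κ := by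
    intro y κ
    by_cases hc : (y, κ) ∈ T
    · -- the finite identity with the singleton class `{(y, κ)}` and `A` restricted to the box of `(y, κ)`
      set S : Finset (Site d × Fin d) := boxFinset (loK L j y) (bondHiK L j y κ) ×ˢ Finset.univ with hS
      set A₀ : Site d → Fin d → 𝔸 := fun x μ => if x ∈ boxFinset (loK L j y) (bondHiK L j y κ) then A x μ else 0 with hA₀
      have hA₀S : ∀ b : Site d × Fin d, b ∉ S → A₀ b.1 b.2 = 0 := by
        intro b hb
        simp only [hA₀]
        rw [if_neg]
        intro hb1
        exact hb (Finset.mem_product.2 ⟨hb1, Finset.mem_univ _⟩)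
      have hB₀ : ∀ c : Site d × Fin d, c ∉ ({(y, κ)} : Finset (Site d × Fin d)) → bump y κ (B y κ) c.1 c.2 = 0 := by
        intro c hc'
        rw [Finset.mem_singleton] at hc'
        simp only [bump]
        rw [if_neg]
        rintro ⟨h1', h2'⟩
        exact hc' (Prod.ext h1' h2')
      have hT₀ : ∀ c ∈ ({(y, κ)} : Finset (Site d × Fin d)), ∀ x, InBox (loK L j c.1) (bondHiK L j c.1 c.2) x → x ∈ Ω j := by
        intro c hc' x hx
        rw [Finset.mem_singleton] at hc'
        subst hc'
        exact hT _ hc x hx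
      have hbb := tauForm_linCovIterT_pair τ hL hτp hα hαQ hU₀ hreg hj {(y, κ)} hT₀ (bump y κ (B y κ)) hB₀ S A₀ hA₀S
      rw [Finset.sum_singleton] at hbb
      have hbump : bump y κ (B y κ) y κ = B y κ := by simp [bump]
      have hloc : linCovIter L U₀ A₀ j y κ = linCovIter L U₀ A j y κ :=
        B9Ineq3137LocalSup.linCovIter_congr L hL1 j y κ (fun _ _ _ _ => rfl) (fun x μ hx _ => by
          simp only [hA₀]; rw [if_pos (mem_boxFinset.2 hx)])
      rw [hbump, hloc] at hbb
      rw [← hbb]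
      -- LHS of the finite identity: unfold the transpose against the bump
      have hterm : ∀ b ∈ S, tauForm τ (linCovIterT τ L U₀ j (bump y κ (B y κ)) b.1 b.2) (A₀ b.1 b.2) =
          ∑ t : Fin 2, if winBase L j b.1 κ t = y then F b.1 b.2 y κ else 0 := by
        intro b hb
        have hbA : A₀ b.1 b.2 = A b.1 b.2 := by
          simp only [hA₀]; rw [if_pos (Finset.mem_product.1 hb).1]
        rw [hbA, h1]
        rw [Finset.sum_eq_single κ]
        · refine Finset.sum_congr rfl fun t _ => ?_
          by_cases hw : winBase L j b.1 κ t = y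
          · rw [if_pos hw]
            simp only [hF, bump, hw, and_self, if_true]
          · rw [if_neg hw]
            have h0 : bump y κ (B y κ) (winBase L j b.1 κ t) κ = 0 := by
              simp only [bump]; rw [if_neg]; exact fun h => hw h.1
            rw [h0, entryT_zero, map_zero, LinearMap.zero_apply]
        · intro κ' _ hκ'
          refine Finset.sum_eq_zero fun t _ => ?_
          have h0 : bump y κ (B y κ) (winBase L j b.1 κ' t) κ' = 0 := by
            simp only [bump]; rw [if_neg]; exact fun h => hκ' h.2
          rw [h0, entryT_zero, map_zero, LinearMap.zero_apply]
        · intro h; exact absurd (Finset.mem_univ κ) h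
      rw [Finset.sum_congr rfl hterm, hS, Finset.sum_product]
      -- `Σ_x Σ_μ Σ_t [w x = y] F = Σ_t Σ_μ Σ_{x | w x = y} F`
      simp only [Finset.sum_filter]
      calc ∑ x ∈ boxFinset (loK L j y) (bondHiK L j y κ), ∑ μ : Fin d, ∑ t : Fin 2, (if winBase L j x κ t = y then F x μ y κ else 0)
          = ∑ x ∈ boxFinset (loK L j y) (bondHiK L j y κ), ∑ t : Fin 2, ∑ μ : Fin d, (if winBase L j x κ t = y then F x μ y κ else 0) :=
            Finset.sum_congr rfl fun x _ => Finset.sum_comm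
        _ = ∑ t : Fin 2, ∑ x ∈ boxFinset (loK L j y) (bondHiK L j y κ), ∑ μ : Fin d, (if winBase L j x κ t = y then F x μ y κ else 0) :=
            Finset.sum_comm
        _ = ∑ t : Fin 2, ∑ μ : Fin d, ∑ x ∈ boxFinset (loK L j y) (bondHiK L j y κ), (if winBase L j x κ t = y then F x μ y κ else 0) :=
            Finset.sum_congr rfl fun t _ => Finset.sum_comm
    · -- off the class both sides vanish
      have hB0 : B y κ = 0 := hBT (y, κ) hc
      simp only [hF, hB0, entryT_zero, map_zero, LinearMap.zero_apply, Finset.sum_const_zero]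
  -- (4) assemble: both sides are `Σ_κ Σ_t Σ_μ Σ_{x ∈ cell} F x μ (winBase x κ t) κ`
  have hG : ∀ (κ : Fin d) (t : Fin 2) (μ : Fin d), IsPeriodic P fun x => F x μ (winBase L j x κ t) κ := by
    intro κ t μ x n
    have hw : winBase L j (x + (P : ℤ) • n) κ t = winBase L j x κ t + (Q : ℤ) • n := by
      rw [hPQ]; exact winBase_add_pow_mul_smul hL1 j (Q : ℤ) x n κ t
    show F (x + (P : ℤ) • n) μ (winBase L j (x + (P : ℤ) • n) κ t) κ = F x μ (winBase L j x κ t) κ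
    rw [hw, h2]
  calc ∑ μ : Fin d, ∑ x ∈ box (d := d) P, tauForm τ (linCovIterT τ L U₀ j B x μ) (A x μ)
      = ∑ μ : Fin d, ∑ x ∈ box (d := d) P, ∑ κ : Fin d, ∑ t : Fin 2, F x μ (winBase L j x κ t) κ := by
        refine Finset.sum_congr rfl fun μ _ => Finset.sum_congr rfl fun x _ => ?_
        rw [h1]
    _ = ∑ μ : Fin d, ∑ κ : Fin d, ∑ x ∈ box (d := d) P, ∑ t : Fin 2, F x μ (winBase L j x κ t) κ :=
        Finset.sum_congr rfl fun μ _ => Finset.sum_comm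
    _ = ∑ κ : Fin d, ∑ μ : Fin d, ∑ x ∈ box (d := d) P, ∑ t : Fin 2, F x μ (winBase L j x κ t) κ := Finset.sum_comm
    _ = ∑ κ : Fin d, ∑ μ : Fin d, ∑ t : Fin 2, ∑ x ∈ box (d := d) P, F x μ (winBase L j x κ t) κ :=
        Finset.sum_congr rfl fun κ _ => Finset.sum_congr rfl fun μ _ => Finset.sum_comm
    _ = ∑ κ : Fin d, ∑ t : Fin 2, ∑ μ : Fin d, ∑ x ∈ box (d := d) P, F x μ (winBase L j x κ t) κ :=
        Finset.sum_congr rfl fun κ _ => Finset.sum_comm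
    _ = ∑ κ : Fin d, ∑ t : Fin 2, ∑ μ : Fin d, ∑ y ∈ box (d := d) Q,
          ∑ x ∈ (boxFinset (loK L j y) (bondHiK L j y κ)).filter (fun x => winBase L j x κ t = y), F x μ y κ := by
        refine Finset.sum_congr rfl fun κ _ => Finset.sum_congr rfl fun t _ => Finset.sum_congr rfl fun μ _ => ?_
        rw [← sum_box_coarse_fibre hL1 j hPQ (hG κ t μ) κ t]
        refine Finset.sum_congr rfl fun y _ => Finset.sum_congr rfl fun x hx => ?_
        rw [(Finset.mem_filter.1 hx).2]
    _ = ∑ κ : Fin d, ∑ t : Fin 2, ∑ y ∈ box (d := d) Q, ∑ μ : Fin d,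
          ∑ x ∈ (boxFinset (loK L j y) (bondHiK L j y κ)).filter (fun x => winBase L j x κ t = y), F x μ y κ :=
        Finset.sum_congr rfl fun κ _ => Finset.sum_congr rfl fun t _ => Finset.sum_comm
    _ = ∑ κ : Fin d, ∑ y ∈ box (d := d) Q, ∑ t : Fin 2, ∑ μ : Fin d,
          ∑ x ∈ (boxFinset (loK L j y) (bondHiK L j y κ)).filter (fun x => winBase L j x κ t = y), F x μ y κ :=
        Finset.sum_congr rfl fun κ _ => Finset.sum_comm
    _ = ∑ κ : Fin d, ∑ y ∈ box (d := d) Q, tauForm τ (B y κ) (linCovIter L U₀ A j y κ) :=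
        Finset.sum_congr rfl fun κ _ => Finset.sum_congr rfl fun y _ => (h3 y κ).symm

end Pairing

/-! ## §3  `⟨A, Q*aQ(U₀)A⟩_per` level by level; at the flat background a sum of squares over the class bonds of the coarse cells -/

section Letter

variable (τ : 𝔸 →ₗ[ℂ] ℂ) [FiniteDimensional ℝ 𝔸] [Nontrivial 𝔸] {L : ℕ} (P : ℕ) [NeZero P]

omit [CStarAlgebra 𝔸] [FiniteDimensional ℝ 𝔸] [Nontrivial 𝔸] [NeZero P] in
/-- `Lʲ ∣ P` for `j ≤ m` when `Lᵐ ∣ P`, in the form `P = Lʲ·(P ∕ Lʲ)` over `ℤ`. [folklore] -/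
private theorem cast_eq_pow_mul_div {m j : ℕ} (hdvd : L ^ m ∣ P) (hjm : j ≤ m) : (P : ℤ) = (L : ℤ) ^ j * ((P / L ^ j : ℕ) : ℤ) := by
  exact_mod_cast (Nat.mul_div_cancel' ((pow_dvd_pow L hjm).trans hdvd)).symm

omit [CStarAlgebra 𝔸] [FiniteDimensional ℝ 𝔸] [Nontrivial 𝔸] in
/-- the coarse period `P ∕ Lʲ` is non-zero. [folklore] -/
private theorem neZero_div {m j : ℕ} (hdvd : L ^ m ∣ P) (hjm : j ≤ m) : NeZero (P / L ^ j) := by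
  refine ⟨(Nat.div_pos (Nat.le_of_dvd (Nat.pos_of_ne_zero (NeZero.ne P)) ((pow_dvd_pow L hjm).trans hdvd)) ?_).ne'⟩
  rcases Nat.eq_zero_or_pos (L ^ j) with h0 | hpos
  · exfalso
    have : (0 : ℕ) ∣ P := by rw [← h0]; exact (pow_dvd_pow L hjm).trans hdvd
    exact NeZero.ne P (Nat.eq_zero_of_zero_dvd this)
  · exact hpos

omit [FiniteDimensional ℝ 𝔸] [Nontrivial 𝔸] [NeZero P] in
/-- off its class the level-`j` input `𝟙_{Λ_j}·(LʲηQ_jA)` vanishes. [cite: Balaban1985BackgroundPropagators, (3.16) p.393 (bookkeeping)] -/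
theorem clsField_of_not_mem (ΛbP : ℕ → ℕ → Set (Site d × Fin d)) (η : ℝ) (m j : ℕ) (U₀ : Site d → Fin d → 𝔸ˣ) (A : Site d → Fin d → 𝔸)
    {c : Site d × Fin d} (hc : c ∉ ΛbP m j) : clsField L ΛbP η m j U₀ A c.1 c.2 = 0 := by
  classical
  simp only [clsField]
  rw [if_neg hc]

/-- ★★ **`⟨A, Q*aQ(U₀)A⟩_per` LEVEL BY LEVEL ON THE TORUS**: at a `P`-periodic unitary `U₀` in the letter's regime (the class (1.7) at window `α_Q∕L²`),
`Lᵐ ∣ P`, class sections `(P∕Lʲ)`-periodic and class boxes in `Ω_{j−1}` ([B8] (1.31)), for a `P`-periodic `A`: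
`⟨A, Q*aQ(U₀)A⟩_per = Σ_{j≤m} w_j Σ_κ Σ_{y ∈ [0,P∕Lʲ)ᵈ} ⟨(𝟙_{Λ_j}LʲηQ_j(U₀)A)(y,κ), (LʲQ_j(U₀)A)(y,κ)⟩_τ` — print's `Σ_j (Lʲη)⁻²⟨Λ_jQ_jA, Λ_jQ_jA⟩` of (3.16)
summed over the torus `T^{(j)}`. [cite: Balaban1985BackgroundPropagators, (3.16)–(3.17) p.393; Balaban1985RegularSpaces, (1.56), (1.58) p.86, (1.31) p.82, p.77 («Ω_j = T_η»); Balaban1985Averaging, (147) p.40] -/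
theorem bondPairPer_QQZdP_eq_sum (hL : 2 ≤ L) (hτp : ∀ a : 𝔸, a ≠ 0 → 0 < (τ (star a * a)).re) (hτs : ∀ a : 𝔸, τ (star a) = starRingEnd ℂ (τ a))
    (ΛbP : ℕ → ℕ → Set (Site d × Fin d)) (i : ZdIdx d L) {m : ℕ} (hdvd : L ^ m ∣ P)
    (hΛ : ∀ j, j ≤ m → ∀ κ : Fin d, IsPeriodic (P / L ^ j) (fun z => (z, κ) ∈ ΛbP m j))
    (hbox : ∀ j, j ≤ m → ∀ c ∈ ΛbP m j, ∀ x, InBox (loK L j c.1) (bondHiK L j c.1 c.2) x → x ∈ i.Ω (j - 1))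
    {U₀ : Site d → Fin d → 𝔸ˣ} (hU₀ : ∀ x κ, U₀ x κ ∈ unitaryUnits 𝔸) (hU : IsPeriodic P U₀) (hreg : Reg17 L m i.Ω (alphaQ d L / (L : ℝ) ^ 2) U₀)
    {A : Site d → Fin d → 𝔸} (hA : IsPeriodic P A) :
    bondPairPer τ P A (QQZdP τ L ΛbP i m U₀ A) =
      ∑ j ∈ Finset.range (m + 1), wQ (d := d) L i.η j *
        ∑ κ : Fin d, ∑ y ∈ box (d := d) (P / L ^ j), tauForm τ (clsField L ΛbP i.η m j U₀ A y κ) (linCovIter L U₀ A j y κ) := by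
  classical
  have hL1 : 1 ≤ L := le_trans (by norm_num) hL
  have hL0 : (0 : ℝ) < L := by exact_mod_cast hL1
  have hαpos : 0 < alphaQ d L / (L : ℝ) ^ 2 * (L : ℝ) ^ 2 := by
    have := alphaQ_pos d hL1; positivity
  have hαle : alphaQ d L / (L : ℝ) ^ 2 * (L : ℝ) ^ 2 ≤ alphaQ d L := by
    rw [div_mul_cancel₀ _ (by positivity)]
  have hreg' := reg17_shift hL1 hreg
  -- unfold the pairing and the letter, use symmetry of `⟨·,·⟩_τ`
  have hpt : ∀ (x : Site d) (μ : Fin d), (τ (star (A x μ) * QQZdP τ L ΛbP i m U₀ A x μ)).re =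
      ∑ j ∈ Finset.range (m + 1), wQ (d := d) L i.η j * tauForm τ (linCovIterT τ L U₀ j (clsField L ΛbP i.η m j U₀ A) x μ) (A x μ) := by
    intro x μ
    rw [← tauForm_apply, (tauForm_isSymm τ hτs).eq, QQZdP_of_reg17 τ L hreg A x μ, map_sum, LinearMap.sum_apply]
    refine Finset.sum_congr rfl fun j _ => ?_
    rw [map_smul, LinearMap.smul_apply, smul_eq_mul]
  rw [bondPairPer]
  simp_rw [hpt]
  calc ∑ μ : Fin d, ∑ x ∈ box (d := d) P, ∑ j ∈ Finset.range (m + 1),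
          wQ (d := d) L i.η j * tauForm τ (linCovIterT τ L U₀ j (clsField L ΛbP i.η m j U₀ A) x μ) (A x μ)
      = ∑ μ : Fin d, ∑ j ∈ Finset.range (m + 1), ∑ x ∈ box (d := d) P,
          wQ (d := d) L i.η j * tauForm τ (linCovIterT τ L U₀ j (clsField L ΛbP i.η m j U₀ A) x μ) (A x μ) :=
        Finset.sum_congr rfl fun μ _ => Finset.sum_comm
    _ = ∑ j ∈ Finset.range (m + 1), ∑ μ : Fin d, ∑ x ∈ box (d := d) P,
          wQ (d := d) L i.η j * tauForm τ (linCovIterT τ L U₀ j (clsField L ΛbP i.η m j U₀ A) x μ) (A x μ) := Finset.sum_comm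
    _ = ∑ j ∈ Finset.range (m + 1), wQ (d := d) L i.η j *
          ∑ μ : Fin d, ∑ x ∈ box (d := d) P, tauForm τ (linCovIterT τ L U₀ j (clsField L ΛbP i.η m j U₀ A) x μ) (A x μ) := by
        refine Finset.sum_congr rfl fun j _ => ?_
        rw [Finset.mul_sum]
        exact Finset.sum_congr rfl fun μ _ => by rw [Finset.mul_sum]
    _ = _ := by
        refine Finset.sum_congr rfl fun j hj => ?_
        have hjm : j ≤ m := Nat.lt_succ_iff.mp (Finset.mem_range.mp hj)
        haveI := neZero_div P hdvd hjm
        rw [sum_box_tauForm_linCovIterT_eq τ hL hτp hαpos hαle hU₀ hU hreg' hjm (cast_eq_pow_mul_div P hdvd hjm) (ΛbP m j) (hbox j hjm)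
          (fun c hc => clsField_of_not_mem ΛbP i.η m j U₀ A hc) (isPeriodic_clsField hU hA i.η (cast_eq_pow_mul_div P hdvd hjm) (hΛ j hjm)) hA]

open Classical in
/-- ★★ **AT THE FLAT BACKGROUND `⟨A, Q*aQ(1)A⟩_per = η·Σ_{j≤m} w_j Σ_κ Σ_{y ∈ [0,P∕Lʲ)ᵈ, (y,κ) ∈ Λ_j} Re τ|(LʲηQ_j(1)A)(y,κ)|²`** for a `P`-periodic `A`
(`Lᵐ ∣ P`, periodic class sections; at `U₀ = 1` the class (1.7) holds for every domain sequence, so no box law is needed) — the torus twin of the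
lineage's `B9Thm311FlatHermKernelZd.bondPair_QQZdP_one_eq`. [cite: Balaban1985BackgroundPropagators, (3.16)–(3.17) p.393; Balaban1985RegularSpaces, (1.58) p.86, p.77 («Ω_j = T_η»); Balaban1985Averaging, (127) p.37, (147) p.40] -/
theorem bondPairPer_QQZdP_one_eq (hL : 2 ≤ L) (hτp : ∀ a : 𝔸, a ≠ 0 → 0 < (τ (star a * a)).re) (hτs : ∀ a : 𝔸, τ (star a) = starRingEnd ℂ (τ a))
    (ΛbP : ℕ → ℕ → Set (Site d × Fin d)) (i : ZdIdx d L) {m : ℕ} (hdvd : L ^ m ∣ P)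
    (hΛ : ∀ j, j ≤ m → ∀ κ : Fin d, IsPeriodic (P / L ^ j) (fun z => (z, κ) ∈ ΛbP m j))
    {A : Site d → Fin d → 𝔸} (hA : IsPeriodic P A) :
    bondPairPer τ P A (QQZdP τ L ΛbP i m (1 : Site d → Fin d → 𝔸ˣ) A) =
      i.η * ∑ j ∈ Finset.range (m + 1), wQ (d := d) L i.η j *
        ∑ κ : Fin d, ∑ y ∈ box (d := d) (P / L ^ j),
          if (y, κ) ∈ ΛbP m j then (τ (star (linCovIter L (1 : Site d → Fin d → 𝔸ˣ) A j y κ) * linCovIter L (1 : Site d → Fin d → 𝔸ˣ) A j y κ)).re else 0 := by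
  classical
  have hL1 : 1 ≤ L := le_trans (by norm_num) hL
  have hη : 0 < i.η := i.hη
  have hLr : (0 : ℝ) < (L : ℝ) ^ 2 := by positivity
  have hreg : Reg17 L m i.Ω (alphaQ d L / (L : ℝ) ^ 2) (1 : Site d → Fin d → 𝔸ˣ) := reg17_one hL1 (div_pos (alphaQ_pos d hL1) hLr)
  have h1u : ∀ (x : Site d) (κ : Fin d), (1 : Site d → Fin d → 𝔸ˣ) x κ ∈ unitaryUnits 𝔸 := fun _ _ => (unitaryUnits 𝔸).one_mem
  have h1per : IsPeriodic P (1 : Site d → Fin d → 𝔸ˣ) := fun _ _ => rfl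
  obtain ⟨M₀, hM₀, hAM⟩ := exists_bound_of_isPeriodic_bond P hA
  -- the class field at level `j` is `η·𝟙_{Λ_j}·Q_j(1)A`
  have hcls : ∀ (j : ℕ) (y : Site d) (κ : Fin d), clsField L ΛbP i.η m j (1 : Site d → Fin d → 𝔸ˣ) A y κ =
      if (y, κ) ∈ ΛbP m j then (i.η : ℝ) • linCovIter L (1 : Site d → Fin d → 𝔸ˣ) A j y κ else 0 := by
    intro j y κ
    simp only [clsField]
    split_ifs with hc
    · have hi : B8Eq146AExpansion.iEta i.η A = ((Complex.I : ℂ) * i.η) • A := by funext y τ'; rfl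
      rw [hi, B9Thm311FlatHermKernelZd.linCovIter_one_smul_complex hL1 _ hM₀ hAM j y κ, smul_smul, ← mul_assoc]
      have : (-Complex.I * Complex.I * (i.η : ℂ)) = ((i.η : ℝ) : ℂ) := by rw [neg_mul, Complex.I_mul_I, neg_neg, one_mul]
      rw [this, Complex.coe_smul]
    · rfl
  -- unfold, symmetry, the summed identity with the trivial box law `Ω ≡ ℤᵈ`
  have hpt : ∀ (x : Site d) (μ : Fin d), (τ (star (A x μ) * QQZdP τ L ΛbP i m 1 A x μ)).re =
      ∑ j ∈ Finset.range (m + 1), wQ (d := d) L i.η j * tauForm τ (linCovIterT τ L 1 j (clsField L ΛbP i.η m j 1 A) x μ) (A x μ) := by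
    intro x μ
    rw [← tauForm_apply, (tauForm_isSymm τ hτs).eq, QQZdP_of_reg17 τ L hreg A x μ, map_sum, LinearMap.sum_apply]
    refine Finset.sum_congr rfl fun j _ => ?_
    rw [map_smul, LinearMap.smul_apply, smul_eq_mul]
  rw [bondPairPer]
  simp_rw [hpt]
  calc ∑ μ : Fin d, ∑ x ∈ box (d := d) P, ∑ j ∈ Finset.range (m + 1),
          wQ (d := d) L i.η j * tauForm τ (linCovIterT τ L 1 j (clsField L ΛbP i.η m j 1 A) x μ) (A x μ)
      = ∑ μ : Fin d, ∑ j ∈ Finset.range (m + 1), ∑ x ∈ box (d := d) P,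
          wQ (d := d) L i.η j * tauForm τ (linCovIterT τ L 1 j (clsField L ΛbP i.η m j 1 A) x μ) (A x μ) :=
        Finset.sum_congr rfl fun μ _ => Finset.sum_comm
    _ = ∑ j ∈ Finset.range (m + 1), ∑ μ : Fin d, ∑ x ∈ box (d := d) P,
          wQ (d := d) L i.η j * tauForm τ (linCovIterT τ L 1 j (clsField L ΛbP i.η m j 1 A) x μ) (A x μ) := Finset.sum_comm
    _ = ∑ j ∈ Finset.range (m + 1), wQ (d := d) L i.η j *
          ∑ μ : Fin d, ∑ x ∈ box (d := d) P, tauForm τ (linCovIterT τ L 1 j (clsField L ΛbP i.η m j 1 A) x μ) (A x μ) := by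
        refine Finset.sum_congr rfl fun j _ => ?_
        rw [Finset.mul_sum]
        exact Finset.sum_congr rfl fun μ _ => by rw [Finset.mul_sum]
    _ = ∑ j ∈ Finset.range (m + 1), wQ (d := d) L i.η j *
          ∑ κ : Fin d, ∑ y ∈ box (d := d) (P / L ^ j), tauForm τ (clsField L ΛbP i.η m j 1 A y κ) (linCovIter L 1 A j y κ) := by
        refine Finset.sum_congr rfl fun j hj => ?_
        have hjm : j ≤ m := Nat.lt_succ_iff.mp (Finset.mem_range.mp hj)
        haveI := neZero_div P hdvd hjm
        rw [sum_box_tauForm_linCovIterT_eq τ hL hτp (m := m) (Ω := fun _ => (Set.univ : Set (Site d))) (alphaQ_pos d hL1) le_rfl h1u h1per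
          (reg17_one hL1 (alphaQ_pos d hL1)) hjm (cast_eq_pow_mul_div P hdvd hjm) (ΛbP m j) (fun _ _ _ _ => Set.mem_univ _)
          (fun c hc => clsField_of_not_mem ΛbP i.η m j 1 A hc) (isPeriodic_clsField h1per hA i.η (cast_eq_pow_mul_div P hdvd hjm) (hΛ j hjm)) hA]
    _ = _ := by
        rw [Finset.mul_sum]
        refine Finset.sum_congr rfl fun j _ => ?_
        rw [mul_left_comm]
        congr 1
        rw [Finset.mul_sum]
        refine Finset.sum_congr rfl fun κ _ => ?_
        rw [Finset.mul_sum]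
        refine Finset.sum_congr rfl fun y _ => ?_
        rw [hcls j y κ]
        split_ifs with hc
        · rw [tauForm_apply, star_smul, star_trivial, smul_mul_assoc, ← Complex.coe_smul, map_smul, smul_eq_mul, Complex.re_ofReal_mul]
        · rw [map_zero, LinearMap.zero_apply, mul_zero]

end Letter

/-! ## §4  The kernel conditions on the torus: `⟨A, Δ_a(1)A⟩_per ≤ 0` ⟹ closed ∧ `R^per(1)D¹*A = 0` ∧ all class averages vanish -/

section Kernel

variable (τ : 𝔸 →ₗ[ℂ] ℂ) [FiniteDimensional ℝ 𝔸] [Nontrivial 𝔸] {L : ℕ} (P : ℕ) [NeZero P]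

omit [FiniteDimensional ℝ 𝔸] [Nontrivial 𝔸] in
/-- **`R^per(U₀)` READ ON `ℤᵈ` AT A PERIODIC INPUT IS THE PROJECTION ITSELF**: `projRPer … (D^{η*}_{U₀}A) = ↑(projEPer … ⟨D^{η*}_{U₀}A, ·⟩)` for periodic
`U₀`, `A` (periodisation by representatives is the identity on periodic functions). [cite: Balaban1985BackgroundPropagators, (3.21)–(3.22) p.394; Balaban1985RegularSpaces, p.77 («Ω_j = T_η»)] -/
theorem projRPer_covDivB_eq_coe (L m : ℕ) (η : ℝ) (Λs : ℕ → Set (Site d)) {U₀ : Site d → Fin d → 𝔸ˣ} (hU : IsPeriodic P U₀)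
    {A : Site d → Fin d → 𝔸} (hA : IsPeriodic P A) :
    projRPer τ P L m η Λs U₀ (covDivB η U₀ A) =
      ((projEPer τ P L m η Λs U₀ ⟨covDivB η U₀ A, isPeriodic_covDivB hU hA⟩ : perSub (𝔸 := 𝔸) (d := d) P) : Site d → 𝔸) := by
  have h1 : (⟨perRestrict P (covDivB η U₀ A), B9Eq321LandauProjectionZdPer.perRestrict_mem_perSub P _⟩ : perSub (𝔸 := 𝔸) (d := d) P) =
      ⟨covDivB η U₀ A, isPeriodic_covDivB hU hA⟩ :=
    Subtype.ext (perRestrict_eq_self P (isPeriodic_covDivB hU hA))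
  rw [projRPer, h1]

open Classical in
/-- ★★★ **THE KERNEL CONDITIONS AT THE FLAT BACKGROUND ON `T_P`.**  For the genuine torus record `opsAllZdPer τ L P ΛbP ops₀` at a member `(M, i, m)` with
`Lᵐ ∣ P` and `(P∕Lʲ)`-periodic class sections, and a `P`-periodic `A` with `⟨A, Δ_a(1)A⟩_per ≤ 0` (in particular if `Δ_a(1)A = 0`): (a) `A` is CLOSED on the
cell's plaquettes `ν < κ` (hence everywhere), (b) its periodic Landau projection vanishes, `R^per(1)(D^{η*}_1A) = 0`, (c) every class average in the coarse
cells vanishes, `(LʲηQ_j(1)A)(y,κ) = 0` for `(y,κ) ∈ Λ_j`, `y ∈ [0,P∕Lʲ)ᵈ`, `j ≤ m` — because `⟨A, Δ_a(1)A⟩_per = Σ|D^η_1A|² + ‖R^per(1)D*A‖²_per +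
η Σ_j w_j Σ_{Λ_j ∩ cell} |LʲηQ_j(1)A|²` with every summand `≥ 0` (FILE `…GreenZdHermPer`'s energy identity, FILE `…AllLettersZdPer`'s square, §3, `Δ′(1) = 0`).
[cite: Balaban1985BackgroundPropagators, (3.26) p.395, (3.10) p.392, (3.16) p.393, (3.20)–(3.22) p.394, Thm 3.11 p.416; Balaban1985RegularSpaces, p.77 («Ω_j = T_η»)] -/
theorem kernel_conditions_per_of_bondPairPer_nonpos (hτt : ∀ a b : 𝔸, τ (a * b) = τ (b * a))
    (hτs : ∀ a : 𝔸, τ (star a) = starRingEnd ℂ (τ a)) (hτp : ∀ a : 𝔸, a ≠ 0 → 0 < (τ (star a * a)).re)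
    (hL : 2 ≤ L) (ΛbP : ℕ → ℕ → Set (Site d × Fin d)) (ops₀ : ℝ → ZdIdx d L → ℕ → OpsZd d 𝔸) (M : ℝ) (i : ZdIdx d L) {m : ℕ}
    (hdvd : L ^ m ∣ P) (hΛ : ∀ j, j ≤ m → ∀ κ : Fin d, IsPeriodic (P / L ^ j) (fun z => (z, κ) ∈ ΛbP m j))
    {A : Site d → Fin d → 𝔸} (hA : IsPeriodic P A)
    (h : bondPairPer τ P A (deltaAOf i.η (opsAllZdPer τ L P ΛbP ops₀ M i m) 1 A) ≤ 0) :
    (∀ (κ : Fin d), ∀ ν ∈ Finset.Iio κ, ∀ x ∈ box (d := d) P, plaqCovDeriv i.η (1 : Site d → Fin d → 𝔸ˣ) A ν κ x = 0) ∧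
      projRPer τ P L m i.η (i.Λs m) 1 (covDivB i.η 1 A) = 0 ∧
      (∀ j, j ≤ m → ∀ (κ : Fin d), ∀ y ∈ box (d := d) (P / L ^ j), (y, κ) ∈ ΛbP m j →
        linCovIter L (1 : Site d → Fin d → 𝔸ˣ) A j y κ = 0) := by
  classical
  have hL1 : 1 ≤ L := le_trans (by norm_num) hL
  have hη : 0 < i.η := i.hη
  have h1u : ∀ (x : Site d) (κ : Fin d), (1 : Site d → Fin d → 𝔸ˣ) x κ ∈ unitaryUnits 𝔸 := fun _ _ => (unitaryUnits 𝔸).one_mem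
  have h1per : IsPeriodic P (1 : Site d → Fin d → 𝔸ˣ) := fun _ _ => rfl
  have nn := B9Thm311FlatHermKernelZd.re_trace_star_mul_self_nonneg' (τ := τ) hτp
  -- the four terms, `Δ′(1) = 0`
  have four := bondPairPer_deltaAOf_opsAllZdPer_eq_four_terms P τ ΛbP ops₀ M i m (1 : Site d → Fin d → 𝔸ˣ) A
  rw [DpZd_one, B9Eq327GreenZdHermPer.bondPairPer_zero_right, add_zero] at four
  -- T1 = the plaquette squares
  have hB : ∀ u ∈ unitaryUnits 𝔸, ∀ a b : 𝔸, tauForm τ (conjR u a) b = tauForm τ a (conjR u⁻¹ b) :=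
    fun u hu a b => by rw [tauForm_apply, tauForm_apply]; exact re_trace_star_pair_invariant τ hτt hu a b
  have hT1 := sum_box_pair_Jcur (tauForm τ) (unitaryUnits 𝔸) P i.η (1 : Site d → Fin d → 𝔸ˣ) hB h1u h1per hA
  simp only [tauForm_apply] at hT1
  have hT1nn : 0 ≤ ∑ κ : Fin d, ∑ ν ∈ Finset.Iio κ, ∑ x ∈ box (d := d) P,
      (τ (star (plaqCovDeriv i.η (1 : Site d → Fin d → 𝔸ˣ) A ν κ x) * plaqCovDeriv i.η 1 A ν κ x)).re :=
    Finset.sum_nonneg fun κ _ => Finset.sum_nonneg fun ν _ => Finset.sum_nonneg fun x _ => nn _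
  -- T3 = the Landau square
  have hT3 := bondPairPer_DRDs_eq_formPer_sq P τ hτt hτs hτp (withDpZd (withQQP τ L ΛbP ops₀)) M i m h1u h1per hA
  set Rf := projEPer τ P L m i.η (i.Λs m) (1 : Site d → Fin d → 𝔸ˣ) ⟨covDivB i.η 1 A, isPeriodic_covDivB h1per hA⟩ with hRf
  have hT3nn : 0 ≤ formPer τ P Rf Rf := by
    rw [formPer_apply]; exact Finset.sum_nonneg fun x _ => nn _
  -- T4 = the averaging squares
  have hT4 := bondPairPer_QQZdP_one_eq τ P hL hτp hτs ΛbP i hdvd hΛ hA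
  have hT4nn : 0 ≤ ∑ j ∈ Finset.range (m + 1), wQ (d := d) L i.η j *
      ∑ κ : Fin d, ∑ y ∈ box (d := d) (P / L ^ j),
        (if (y, κ) ∈ ΛbP m j then (τ (star (linCovIter L (1 : Site d → Fin d → 𝔸ˣ) A j y κ) * linCovIter L 1 A j y κ)).re else 0) :=
    Finset.sum_nonneg fun j _ => mul_nonneg (B9Thm311FlatHermKernelZd.wQ_pos (d := d) hL1 hη j).le
      (Finset.sum_nonneg fun κ _ => Finset.sum_nonneg fun y _ => by split_ifs; exacts [nn _, le_rfl])
  rw [four, hT1, hT3, hT4] at h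
  have hT1z : ∑ κ : Fin d, ∑ ν ∈ Finset.Iio κ, ∑ x ∈ box (d := d) P,
      (τ (star (plaqCovDeriv i.η (1 : Site d → Fin d → 𝔸ˣ) A ν κ x) * plaqCovDeriv i.η 1 A ν κ x)).re = 0 := by
    nlinarith [mul_nonneg hη.le hT4nn]
  have hT3z : formPer τ P Rf Rf = 0 := by nlinarith [mul_nonneg hη.le hT4nn]
  have hT4z : ∑ j ∈ Finset.range (m + 1), wQ (d := d) L i.η j *
      ∑ κ : Fin d, ∑ y ∈ box (d := d) (P / L ^ j),
        (if (y, κ) ∈ ΛbP m j then (τ (star (linCovIter L (1 : Site d → Fin d → 𝔸ˣ) A j y κ) * linCovIter L 1 A j y κ)).re else 0) = 0 := by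
    nlinarith [mul_nonneg hη.le hT4nn]
  refine ⟨fun κ ν hν x hx => ?_, ?_, fun j hj κ y hy hmem => ?_⟩
  · -- (a) closedness on the cell
    have h1 := (Finset.sum_eq_zero_iff_of_nonneg fun κ _ =>
      Finset.sum_nonneg fun ν _ => Finset.sum_nonneg fun x _ => nn _).1 hT1z κ (Finset.mem_univ κ)
    have h2 := (Finset.sum_eq_zero_iff_of_nonneg fun ν _ => Finset.sum_nonneg fun x _ => nn _).1 h1 ν hν
    have h3 := (Finset.sum_eq_zero_iff_of_nonneg fun x _ => nn _).1 h2 x hx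
    exact B9Thm311FlatHermKernelZd.eq_zero_of_re_trace_star_mul_self_eq_zero hτp h3
  · -- (b) the Landau projection
    rw [projRPer_covDivB_eq_coe τ P L m i.η (i.Λs m) h1per hA, ← hRf, formPer_apply_self_eq_zero τ P hτp hT3z, Submodule.coe_zero]
  · -- (c) class averages
    have h1 := (Finset.sum_eq_zero_iff_of_nonneg fun j _ => mul_nonneg (B9Thm311FlatHermKernelZd.wQ_pos (d := d) hL1 hη j).le
      (Finset.sum_nonneg fun κ _ => Finset.sum_nonneg fun y _ => by split_ifs; exacts [nn _, le_rfl])).1 hT4z j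
      (Finset.mem_range.2 (Nat.lt_succ_of_le hj))
    have h2 : ∑ κ : Fin d, ∑ y ∈ box (d := d) (P / L ^ j),
        (if (y, κ) ∈ ΛbP m j then (τ (star (linCovIter L (1 : Site d → Fin d → 𝔸ˣ) A j y κ) * linCovIter L 1 A j y κ)).re else 0) = 0 := by
      rcases mul_eq_zero.1 h1 with h0 | h0
      · exact absurd h0 (B9Thm311FlatHermKernelZd.wQ_pos (d := d) hL1 hη j).ne'
      · exact h0
    have h3 := (Finset.sum_eq_zero_iff_of_nonneg fun κ _ => Finset.sum_nonneg fun y _ => by split_ifs; exacts [nn _, le_rfl]).1 h2 κ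
      (Finset.mem_univ κ)
    have h4 := (Finset.sum_eq_zero_iff_of_nonneg fun y _ => by split_ifs; exacts [nn _, le_rfl]).1 h3 y hy
    rw [if_pos hmem] at h4
    exact B9Thm311FlatHermKernelZd.eq_zero_of_re_trace_star_mul_self_eq_zero hτp h4

end Kernel

/-! ## §5  The all-torus class ([B8] p. 77 «Ω_j = T_η»): class averages zero ⟹ no harmonic part (Q₁) and a `Q′(1)`-null potential (Q₂) -/

section Torus

variable {L : ℕ} (P : ℕ) [NeZero P]

/-- **THE FLAT COMPOSITE OF A DIRECTION-CONSTANT BOND FIELD SCALES IT BY `Lʲ`** (un-normalised currency (127): `L^{jd}` segments of `Lʲ` bonds, weight `L^{−jd}`).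
[cite: Balaban1985Averaging, (125) p.36, (127) p.37; Balaban1984PropagatorsI, (1.18) p.20] -/
theorem linQIter_const {L : ℕ} (hL : 1 ≤ L) (v : Fin d → 𝔸) (j : ℕ) (y : Site d) (κ : Fin d) :
    B7Prop4Flat.linQIter L (fun (_ : Site d) (μ : Fin d) => v μ) j y κ = ((L ^ j : ℕ) : ℝ) • v κ := by
  classical
  rw [B7Prop4Flat.linQIter_eq_linQ_pow, B7Prop4Flat.linQ_eq_sum]
  simp only [Finset.sum_const, Finset.card_univ, Fintype.card_fin, Fintype.card_fun]
  rw [← Nat.cast_smul_eq_nsmul ℝ ((L ^ j) ^ d), ← Nat.cast_smul_eq_nsmul ℝ (L ^ j) (v κ), smul_smul, smul_smul]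
  congr 1
  have hN : ((L ^ j : ℕ) : ℝ) ≠ 0 := by
    have : 0 < L ^ j := pow_pos (by omega) j
    exact_mod_cast this.ne'
  push_cast
  field_simp

variable [Nontrivial 𝔸]

/-- ★ **THE FLAT COMPOSITE OF A POINCARÉ FIELD** ([B9] (3.115) «Q_j d = D_j Q′_j» at `U = 1`, plus the constant part): for `A(x)_μ = (D^η_{1,μ}λ)(x) + v_μ`
with `A`, `λ` periodic (so bounded), `(LʲηQ_j(1)A)(y,κ) = η⁻¹·((Q′_j(1)λ)(y + e_κ) − (Q′_j(1)λ)(y)) + Lʲ·v_κ` — the lineage's `linCovIter_one_grad_alg`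
(block sums) read through `B7Eq214FlatQprime.QprimeIter_one_eq_sum_blockSites`, and §5's constant formula. [cite: Balaban1985BackgroundPropagators, (3.115) p.418, (3.19) p.393; Balaban1985Averaging, (122) + (125) p.36, (127) p.37] -/
theorem linCovIter_one_of_potential_add_const (hL : 1 ≤ L) {η : ℝ} {A : Site d → Fin d → 𝔸} (hA : IsPeriodic P A)
    {lam : Site d → 𝔸} (hlam : IsPeriodic P lam) {v : Fin d → 𝔸}
    (hdec : ∀ (x : Site d) (μ : Fin d), A x μ = covDerivFwd η (1 : Site d → Fin d → 𝔸ˣ) μ lam x + v μ) (j : ℕ) (y : Site d) (κ : Fin d) :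
    linCovIter L (1 : Site d → Fin d → 𝔸ˣ) A j y κ =
      ((η⁻¹ : ℝ) : ℂ) • (QprimeIter (zdBlocking d L) (bgT L (1 : Site d → Fin d → 𝔸ˣ)) j lam (y + e κ) -
          QprimeIter (zdBlocking d L) (bgT L (1 : Site d → Fin d → 𝔸ˣ)) j lam y) + ((L ^ j : ℕ) : ℝ) • v κ := by
  obtain ⟨M₀, hM₀, hAM⟩ := exists_bound_of_isPeriodic_bond P hA
  obtain ⟨Λ, hΛ0, hΛ⟩ := exists_bound_of_isPeriodic_site P hlam
  set dl : Site d → Fin d → 𝔸 := fun x μ => ((η⁻¹ : ℝ) : ℂ) • (lam (x + e μ) - lam x) with hdl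
  set cv : Site d → Fin d → 𝔸 := fun _ μ => v μ with hcv
  have hAeq : A = dl + cv := by
    funext x μ
    rw [hdec x μ, B8Eq191FlatStencils.covDerivFwd_flat_apply, Pi.add_apply, Pi.add_apply, hdl, hcv]
    dsimp only
    rw [Complex.coe_smul]
  have hdlb : ∀ x μ, ‖dl x μ‖ ≤ ‖((η⁻¹ : ℝ) : ℂ)‖ * (Λ + Λ) := fun x μ => by
    rw [hdl]
    dsimp only
    refine (norm_smul_le _ _).trans (mul_le_mul_of_nonneg_left ((norm_sub_le _ _).trans (add_le_add (hΛ _) (hΛ _))) (norm_nonneg _))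
  rw [congrFun (congrFun (B9Eq316TowerFlatIsOneStep.linCovIter_one_left L hL A hM₀ hAM j) y) κ, hAeq, B7Prop5Flat.linQIter_add,
    ← congrFun (congrFun (B9Eq316TowerFlatIsOneStep.linCovIter_one_left L hL dl (by positivity) hdlb j) y) κ, hdl,
    B9SupplySockB9P3ZdSkewGaugeMode.linCovIter_one_grad_alg hL _ hΛ j y κ, hcv, linQIter_const hL v j y κ, bgT_one,
    B7Eq214FlatQprime.QprimeIter_one_eq_sum_blockSites hL lam j, B7Eq214FlatQprime.QprimeIter_one_eq_sum_blockSites hL lam j,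
    ← Finset.smul_sum, ← Finset.smul_sum, ← smul_sub, smul_comm]

/-- ★ **(Q₁) NO HARMONIC PART: AT THE ALL-TORUS CLASS, `Q_m(1)A ≡ 0` KILLS THE CONSTANT PART** of the Poincaré decomposition `A = D^η_1λ + v` (`A`, `λ`
`P`-periodic, `Lᵐ ∣ P`): summing `(LᵐηQ_m(1)A)(y,κ) = η⁻¹·((Q′λ)(y+e_κ) − (Q′λ)(y)) + Lᵐ·v_κ = 0` over the coarse cell telescopes the periodic `Q′_m(1)λ`
away (dag-n06-w4's `isPeriodic_QprimeIter`) and leaves `(P∕Lᵐ)ᵈ·Lᵐ·v_κ = 0`. [cite: Balaban1984PropagatorsI, (1.72) p.30 («thus A₀ = 0»); Balaban1985BackgroundPropagators, (3.115) p.418; Balaban1985RegularSpaces, p.77 («Ω_j = T_η»)] -/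
theorem const_eq_zero_of_linCovIter_one_eq_zero (hL : 1 ≤ L) {η : ℝ} {A : Site d → Fin d → 𝔸} (hA : IsPeriodic P A)
    {lam : Site d → 𝔸} (hlam : IsPeriodic P lam) {v : Fin d → 𝔸}
    (hdec : ∀ (x : Site d) (μ : Fin d), A x μ = covDerivFwd η (1 : Site d → Fin d → 𝔸ˣ) μ lam x + v μ) {m : ℕ} (hdvd : L ^ m ∣ P)
    (hQ : ∀ (y : Site d) (κ : Fin d), linCovIter L (1 : Site d → Fin d → 𝔸ˣ) A m y κ = 0) : v = 0 := by
  set Q : ℕ := P / L ^ m with hQdef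
  haveI : NeZero Q := neZero_div P hdvd le_rfl
  have hPQ : P = L ^ m * Q := (Nat.mul_div_cancel' hdvd).symm
  have h1per : IsPeriodic P (1 : Site d → Fin d → 𝔸ˣ) := fun _ _ => rfl
  have hq : IsPeriodic Q (QprimeIter (zdBlocking d L) (bgT L (1 : Site d → Fin d → 𝔸ˣ)) m lam) :=
    B9Eq321LandauMultiplierIffZdPer.isPeriodic_QprimeIter h1per hlam hPQ
  funext κ
  have hsum := Finset.sum_eq_zero (s := box (d := d) Q) fun y _ => hQ y κ
  simp_rw [linCovIter_one_of_potential_add_const P hL hA hlam hdec m _ κ] at hsum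
  rw [Finset.sum_add_distrib, ← Finset.smul_sum, Finset.sum_sub_distrib, sum_box_shift Q hq (e κ), sub_self, smul_zero, zero_add,
    Finset.sum_const, T4TermwiseTorus.card_box, ← Nat.cast_smul_eq_nsmul ℝ, smul_smul, smul_eq_zero] at hsum
  have hne : ((Q ^ d : ℕ) : ℝ) * ((L ^ m : ℕ) : ℝ) ≠ 0 := by
    have hQ0 : 0 < Q := Nat.pos_of_ne_zero (NeZero.ne Q)
    have hL0 : 0 < L ^ m := pow_pos (by omega) m
    positivity
  exact hsum.resolve_left hne

/-- ★ **(Q₂) THE POTENTIAL IS `Q′_m(1)`-NULL UP TO A CONSTANT AT THE ALL-TORUS CLASS**: for a `P`-periodic Hermitian `λ` with `LᵐηQ_m(1)(D^η_1λ) ≡ 0`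
(`Lᵐ ∣ P`, `η ≠ 0`), `(Q′_m(1)λ)(y + e_κ) = (Q′_m(1)λ)(y)` for all `y, κ`, so the periodic `Q′_m(1)λ` is a CONSTANT `c` (dag-n06-w3's torus Liouville
`periodic_eq_const_of_covDerivFwd_one_eq_zero`), and `λ − c ∈ N_𝔤^per(Q′(1))` for the all-torus constraint class `torusLam m` (`Q′(1)` of a constant is the
constant, dag-n06-w4's `qprimeIter_one_const`). [cite: Balaban1984PropagatorsI, (1.72) p.30 («ω = 0»), p.22; Balaban1985BackgroundPropagators, (3.21) p.394, (3.115) p.418; Balaban1985RegularSpaces, (1.5) p.77, p.77 («Ω_j = T_η»)] -/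
theorem exists_sub_const_mem_gaugeNullPer (hL : 1 ≤ L) {η : ℝ} (hη : η ≠ 0) {lam : Site d → 𝔸} (hlam : IsPeriodic P lam)
    (hsa : ∀ x, IsSelfAdjoint (lam x)) {m : ℕ} (hdvd : L ^ m ∣ P)
    (hQ : ∀ (y : Site d) (κ : Fin d), linCovIter L (1 : Site d → Fin d → 𝔸ˣ) (fun x μ => covDerivFwd η (1 : Site d → Fin d → 𝔸ˣ) μ lam x) m y κ = 0) :
    ∃ c : 𝔸, (fun x => lam x - c) ∈ gaugeNullPer P L m (B8Thm4TorusAt.torusLam m) (1 : Site d → Fin d → 𝔸ˣ) := by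
  haveI : NeZero L := ⟨by omega⟩
  set Q : ℕ := P / L ^ m with hQdef
  haveI : NeZero Q := neZero_div P hdvd le_rfl
  have hPQ : P = L ^ m * Q := (Nat.mul_div_cancel' hdvd).symm
  have h1per : IsPeriodic P (1 : Site d → Fin d → 𝔸ˣ) := fun _ _ => rfl
  set q := QprimeIter (zdBlocking d L) (bgT L (1 : Site d → Fin d → 𝔸ˣ)) m lam with hqdef
  have hq : IsPeriodic Q q := B9Eq321LandauMultiplierIffZdPer.isPeriodic_QprimeIter h1per hlam hPQ
  have hAper : IsPeriodic P (fun x μ => covDerivFwd η (1 : Site d → Fin d → 𝔸ˣ) μ lam x) := fun x n => by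
    funext μ
    exact B9Eq327GreenZdHermPer.isPeriodic_covDerivFwd η h1per μ hlam x n
  -- the coarse gradient of `q` vanishes
  have hD : ∀ (μ : Fin d) (x : Site d), covDerivFwd (1 : ℝ) (1 : Site d → Fin d → 𝔸ˣ) μ q x = 0 := by
    intro μ x
    have h0 := hQ x μ
    rw [linCovIter_one_of_potential_add_const P hL hAper hlam (v := 0) (fun x μ => (add_zero _).symm) m x μ, Pi.zero_apply, smul_zero,
      add_zero, smul_eq_zero] at h0
    have hc : ((η⁻¹ : ℝ) : ℂ) ≠ 0 := by exact_mod_cast inv_ne_zero hη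
    rw [B8Eq191FlatStencils.covDerivFwd_flat_apply, inv_one, one_smul]
    exact h0.resolve_left hc
  have hconst : ∀ x, q x = q 0 := B9Eq172FlatCurlPoincareZdPer.periodic_eq_const_of_covDerivFwd_one_eq_zero Q one_ne_zero hq hD
  refine ⟨q 0, fun x => ?_, fun x n => ?_, fun j hj y hy => ?_⟩
  · -- Hermitian
    have hq0 : IsSelfAdjoint (q 0) := by
      rw [hqdef, bgT_one, B7Eq214FlatQprime.QprimeIter_one_eq_sum_blockSites hL lam m 0, IsSelfAdjoint, star_sum]
      exact Finset.sum_congr rfl fun x _ => by rw [star_smul, star_trivial, (hsa x).star_eq]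
    exact (hsa x).sub hq0
  · -- periodic
    show lam (x + (P : ℤ) • n) - q 0 = lam x - q 0
    rw [hlam x n]
  · -- `Q′(1)`-null on the top lattice (the only constraint level of `torusLam m`)
    have hjm : j = m := (B8Thm4TorusAt.mem_torusLam_iff m j y).1 hy
    subst hjm
    have hsplit : (fun x => lam x - q 0) = fun x => lam x + (fun _ : Site d => -q 0) x := by
      funext x; rw [sub_eq_add_neg]
    rw [hsplit, B7Eq78Linearization.QprimeIter_add]
    beta_reduce
    rw [B9Eq324DeltaPrimeAZdPer.qprimeIter_one_const hL (-q 0) j y, ← hqdef, hconst y, add_neg_cancel]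

end Torus

/-! ## §6  [B9] Theorem 3.11 at the flat background for the genuine torus record: kernel, positivity, `RegularAtHPer` at `U₀ = 1` -/

section Main

variable (τ : 𝔸 →ₗ[ℂ] ℂ) [FiniteDimensional ℝ 𝔸] [Nontrivial 𝔸] {L : ℕ} (P : ℕ) [NeZero P]

omit [CStarAlgebra 𝔸] [FiniteDimensional ℝ 𝔸] [Nontrivial 𝔸] [NeZero P] in
/-- the all-torus bond class has (trivially) periodic sections at every level. [cite: Balaban1985RegularSpaces, (1.37) p.82, p.77 («Ω_j = T_η»)] -/
theorem isPeriodic_mem_torusLamb (Q m j : ℕ) (κ : Fin d) : IsPeriodic Q (fun z : Site d => (z, κ) ∈ B8Thm2TorusMember.torusLamb (d := d) m j) :=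
  fun z n => by simp only [B8Thm2TorusMember.mem_torusLamb_iff]

/-- ★★★ **[B9] THEOREM 3.11 AT THE FLAT BACKGROUND ON THE TORUS — THE KERNEL**: at a member `(M, i, m)` with the ALL-TORUS constraint classes of [B8] p. 77
(`i.Λs m = torusLam m`, bond class `ΛbP m = torusLamb m`; e.g. lit-balaban's `torusIdx`) and `Lᵐ ∣ P`, for a faithful Hermitian tracial `τ` on a
finite-dimensional fibre: a field `A ∈ E_𝔤^per(P)` with `⟨A, Δ_a(1)A⟩_per ≤ 0` for the GENUINE four-letter torus record `opsAllZdPer` is ZERO.  Chain: §4 kernel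
conditions ⇒ (a) closed, (b) `R^per(1)D¹*A = 0`, (c) `Q_m(1)A ≡ 0` on the top torus (periodicity); dag-n06-w3's Hermitian Poincaré lemma `A = D¹λ + v`; §5
(Q₁) `v = 0` ⇒ zero cell sums, (Q₂) every Hermitian periodic potential is `Q′_m(1)`-null up to a constant; dag-n06-w3's
`B9Thm311FlatKernelZdPer.eq_zero_of_mem_domSubHPer_of_flat_squares` closes. [cite: Balaban1985BackgroundPropagators, Thm 3.11 p.416 («Δ_a … positive definite»; «In [4] … G_□(1) is positive»), (3.26) p.395, (3.16) p.393, (3.20)–(3.22) p.394; Balaban1984PropagatorsI, (1.72) p.30; Balaban1985RegularSpaces, p.77 («Ω_j = T_η»)] -/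
theorem eq_zero_of_bondPairPer_deltaAOf_opsAllZdPer_one_nonpos (hτt : ∀ a b : 𝔸, τ (a * b) = τ (b * a))
    (hτs : ∀ a : 𝔸, τ (star a) = starRingEnd ℂ (τ a)) (hτp : ∀ a : 𝔸, a ≠ 0 → 0 < (τ (star a * a)).re)
    (hL : 2 ≤ L) (ops₀ : ℝ → ZdIdx d L → ℕ → OpsZd d 𝔸) (M : ℝ) (i : ZdIdx d L) {m : ℕ}
    (hΛs : i.Λs m = B8Thm4TorusAt.torusLam m) {ΛbP : ℕ → ℕ → Set (Site d × Fin d)} (hΛb : ΛbP m = B8Thm2TorusMember.torusLamb m)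
    (hdvd : L ^ m ∣ P) {A : Site d → Fin d → 𝔸} (hA : A ∈ domSubHPer (d := d) (𝔸 := 𝔸) P)
    (h : bondPairPer τ P A (deltaAOf i.η (opsAllZdPer τ L P ΛbP ops₀ M i m) 1 A) ≤ 0) : A = 0 := by
  have hL1 : 1 ≤ L := le_trans (by norm_num) hL
  have hη : 0 < i.η := i.hη
  have h1per : IsPeriodic P (1 : Site d → Fin d → 𝔸ˣ) := fun _ _ => rfl
  have hΛper : ∀ j, j ≤ m → ∀ κ : Fin d, IsPeriodic (P / L ^ j) (fun z => (z, κ) ∈ ΛbP m j) := fun j _ κ => by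
    rw [hΛb]; exact isPeriodic_mem_torusLamb (P / L ^ j) m j κ
  obtain ⟨hflat, hR, havg⟩ := kernel_conditions_per_of_bondPairPer_nonpos τ P hτt hτs hτp hL ΛbP ops₀ M i hdvd hΛper hA.1 h
  -- (c) everywhere on the top lattice
  set Q : ℕ := P / L ^ m with hQdef
  haveI : NeZero Q := neZero_div P hdvd le_rfl
  have havg' : ∀ (y : Site d) (κ : Fin d), linCovIter L (1 : Site d → Fin d → 𝔸ˣ) A m y κ = 0 := by
    intro y κ
    have hper : IsPeriodic Q (fun z => linCovIter L (1 : Site d → Fin d → 𝔸ˣ) A m z κ) := fun z n =>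
      linCovIter_add_period h1per hA.1 (cast_eq_pow_mul_div P hdvd le_rfl) z n κ
    rw [← hper.apply_tlift y]
    exact havg m le_rfl κ _ (tlift_mem_box _) (by rw [hΛb]; exact (B8Thm2TorusMember.mem_torusLamb_iff m m _).2 rfl)
  -- Poincaré with Hermitian data
  have hflat' := B9Eq172FlatCurlPoincareZdPer.plaqCovDeriv_one_eq_zero_of_lt_of_mem_box P hA.1 hflat
  obtain ⟨lam, v, hper, -, -, hdec⟩ := B9Eq172FlatCurlPoincareZdPer.exists_herm_periodic_potential_add_const_of_flat P hη.ne' hA hflat'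
  -- (Q₁)
  have hv : v = 0 := const_eq_zero_of_linCovIter_one_eq_zero P hL1 hA.1 hper hdec hdvd havg'
  have hsum : ∀ μ : Fin d, ∑ x ∈ box (d := d) P, A x μ = 0 := fun μ =>
    (B9Thm311FlatKernelZdPer.sum_box_eq_zero_iff_const_eq_zero_of_flat P i.η hper hdec μ).2 (by rw [hv, Pi.zero_apply])
  -- (Q₂)
  have hnull : ∀ lam' : Site d → 𝔸, IsPeriodic P lam' → (∀ x, IsSelfAdjoint (lam' x)) →
      (∀ (x : Site d) (μ : Fin d), A x μ = covDerivFwd i.η (1 : Site d → Fin d → 𝔸ˣ) μ lam' x) →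
      ∃ c : 𝔸, (fun y => lam' y - c) ∈ gaugeNullPer P L m (i.Λs m) (1 : Site d → Fin d → 𝔸ˣ) := by
    intro lam' hper' hsa' hdec'
    rw [hΛs]
    refine exists_sub_const_mem_gaugeNullPer P hL1 hη.ne' hper' hsa' hdvd fun y κ => ?_
    have hAe : (fun x μ => covDerivFwd i.η (1 : Site d → Fin d → 𝔸ˣ) μ lam' x) = A := by
      funext x μ; exact (hdec' x μ).symm
    rw [hAe]
    exact havg' y κ
  exact B9Thm311FlatKernelZdPer.eq_zero_of_mem_domSubHPer_of_flat_squares τ P L m (i.Λs m) hτs hτp hη.ne' hA hflat hsum hnull hR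

/-- ★★★ **[B9] THEOREM 3.11 AT THE FLAT BACKGROUND ON THE TORUS — POSITIVE DEFINITENESS OF THE GENUINE `Δ_a(1)` ON `E_𝔤^per(P)`**: same member and
hypotheses; every `0 ≠ A ∈ domSubHPer P` has `0 < ⟨A, Δ_a(1)A⟩_per = bondPairPer τ P A (deltaAOf i.η (opsAllZdPer τ L P ΛbP ops₀ M i m) 1 A)` — [4]'s
«G_□(1) is positive» for the torus datum, the base case of print's proof of Theorem 3.11; the decl dag-n06-w4's openness file cites BY NAME.
[cite: Balaban1985BackgroundPropagators, Thm 3.11 p.416, (3.26)–(3.27) p.395; Balaban1984PropagatorsII, (2.11) p.225; Balaban1985RegularSpaces, p.77 («Ω_j = T_η»)] -/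
theorem bondPairPer_deltaAOf_opsAllZdPer_one_pos (hτt : ∀ a b : 𝔸, τ (a * b) = τ (b * a))
    (hτs : ∀ a : 𝔸, τ (star a) = starRingEnd ℂ (τ a)) (hτp : ∀ a : 𝔸, a ≠ 0 → 0 < (τ (star a * a)).re)
    (hL : 2 ≤ L) (ops₀ : ℝ → ZdIdx d L → ℕ → OpsZd d 𝔸) (M : ℝ) (i : ZdIdx d L) {m : ℕ}
    (hΛs : i.Λs m = B8Thm4TorusAt.torusLam m) {ΛbP : ℕ → ℕ → Set (Site d × Fin d)} (hΛb : ΛbP m = B8Thm2TorusMember.torusLamb m)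
    (hdvd : L ^ m ∣ P) {A : Site d → Fin d → 𝔸} (hA : A ∈ domSubHPer (d := d) (𝔸 := 𝔸) P) (hA0 : A ≠ 0) :
    0 < bondPairPer τ P A (deltaAOf i.η (opsAllZdPer τ L P ΛbP ops₀ M i m) 1 A) := by
  by_contra hle
  exact hA0 (eq_zero_of_bondPairPer_deltaAOf_opsAllZdPer_one_nonpos τ P hτt hτs hτp hL ops₀ M i hΛs hΛb hdvd hA (not_lt.1 hle))

/-- ★★ **`RegularAtHPer` AT THE FLAT BACKGROUND FOR THE GENUINE TORUS RECORD** (the A6 inhabitant of the flat premise of `InvAtHIPer` ∕ `RegularInClassAtHPer`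
for `opsAllZdPer`, and the `U₀ = 1` anchor of dag-n06-w4's openness argument): at a member with the all-torus classes and `Ω_j = ℤᵈ` (e.g. `torusIdx`),
`Lᵐ ∣ P`, `Δ_a(1)` of `opsAllZdPer τ L P ΛbP ops₀` is invertible on `E_𝔤^per(P)` — FILE `…AllLettersZdPer`'s `regularAtHPer_opsAllZdPer_of_pos` fed with §6's
positivity. [cite: Balaban1985BackgroundPropagators, Thm 3.11 p.416, (3.26)–(3.27) p.395; Balaban1985RegularSpaces, (1.58) p.86, p.77 («Ω_j = T_η»)] -/
theorem regularAtHPer_opsAllZdPer_one (hτt : ∀ a b : 𝔸, τ (a * b) = τ (b * a))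
    (hτs : ∀ a : 𝔸, τ (star a) = starRingEnd ℂ (τ a)) (hτp : ∀ a : 𝔸, a ≠ 0 → 0 < (τ (star a * a)).re)
    (hL : 2 ≤ L) (ops₀ : ℝ → ZdIdx d L → ℕ → OpsZd d 𝔸) (M : ℝ) (i : ZdIdx d L) {m : ℕ} (hΩ : ∀ j, i.Ω j = Set.univ)
    (hΛs : i.Λs m = B8Thm4TorusAt.torusLam m) {ΛbP : ℕ → ℕ → Set (Site d × Fin d)} (hΛb : ΛbP m = B8Thm2TorusMember.torusLamb m)
    (hdvd : L ^ m ∣ P) :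
    RegularAtHPer i.η (opsLandauPer τ P (withDpZd (withQQP τ L ΛbP ops₀)) M i m) P (1 : Site d → Fin d → 𝔸ˣ) :=
  regularAtHPer_opsAllZdPer_of_pos τ P hL hτp hτt hτs ΛbP ops₀ M i (fun _ _ => (unitaryUnits 𝔸).one_mem) (fun _ _ => rfl) hdvd
    (fun j _ κ => by rw [hΛb]; exact isPeriodic_mem_torusLamb (P / L ^ j) m j κ)
    (fun j _ _ _ _ x _ => by rw [hΩ]; exact Set.mem_univ x)
    (fun A hA hA0 => bondPairPer_deltaAOf_opsAllZdPer_one_pos τ P hτt hτs hτp hL ops₀ M i hΛs hΛb hdvd hA hA0)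

/-- ★★ **THE SAME AT lit-balaban's TORUS MEMBER `torusIdx`** (`Ω_j = ℤᵈ`, `Λs = torusLam`, `Λb = torusLamb`; record class `ΛbP := (torusIdx hL t).Λb`):
`Δ_a(1)` of the genuine torus record is positive definite on `E_𝔤^per(P)` and `RegularAtHPer` holds at `U₀ = 1`, for every truncation `m` with `Lᵐ ∣ P`.
[cite: Balaban1985BackgroundPropagators, Thm 3.11 p.416, (3.26)–(3.27) p.395; Balaban1985RegularSpaces, p.77 («Ω_j = T_η»), Thm 2 p.83] -/
theorem regularAtHPer_opsAllZdPer_one_torusIdx (hτt : ∀ a b : 𝔸, τ (a * b) = τ (b * a))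
    (hτs : ∀ a : 𝔸, τ (star a) = starRingEnd ℂ (τ a)) (hτp : ∀ a : 𝔸, a ≠ 0 → 0 < (τ (star a * a)).re)
    (hL : 2 ≤ L) (hL1 : 1 ≤ L) (t : B8Thm2TorusMember.TorusMember) (ops₀ : ℝ → ZdIdx d L → ℕ → OpsZd d 𝔸) (M : ℝ) {m : ℕ} (hdvd : L ^ m ∣ P) :
    (∀ A ∈ domSubHPer (d := d) (𝔸 := 𝔸) P, A ≠ 0 →
      0 < bondPairPer τ P A (deltaAOf (B8Thm2TorusMember.torusIdx (d := d) hL1 t).η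
        (opsAllZdPer τ L P (B8Thm2TorusMember.torusIdx (d := d) hL1 t).Λb ops₀ M (B8Thm2TorusMember.torusIdx hL1 t) m) 1 A)) ∧
    RegularAtHPer (B8Thm2TorusMember.torusIdx (d := d) hL1 t).η
      (opsLandauPer τ P (withDpZd (withQQP τ L (B8Thm2TorusMember.torusIdx (d := d) hL1 t).Λb ops₀)) M (B8Thm2TorusMember.torusIdx hL1 t) m) P
      (1 : Site d → Fin d → 𝔸ˣ) :=
  ⟨fun _ hA hA0 => bondPairPer_deltaAOf_opsAllZdPer_one_pos τ P hτt hτs hτp hL ops₀ M (B8Thm2TorusMember.torusIdx hL1 t) rfl rfl hdvd hA hA0,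
    regularAtHPer_opsAllZdPer_one τ P hτt hτs hτp hL ops₀ M (B8Thm2TorusMember.torusIdx hL1 t) (fun _ => rfl) rfl rfl hdvd⟩

end Main

end Literature.MathematicalPhysics.QuantumFieldTheory.Balaban1983to89.B9Thm311FlatPositivityZdPer

end
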